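import Literature.NumberTheory.GaloisRepresentations.ConjugationDescent
import HarnessLib

/-!
# Restriction of continuous 1-cocycles to a normal subgroup acting trivially

Generic cocycle algebra (the explicit form of the restriction map `H¹(G, X) → Hom_G(H, X) =
H¹(H, X)^{G/H}` of the inflation–restriction sequence, Serre *Corps locaux* VII §5–§6), typed for
the `μ`-transfer core of BSD crux 19276 (HOME/koly/MU-TRANSFER-PROOF.md (F8) / §5 STEP 1): for a
continuous 1-cocycle `φ` of a topological representation `X` of `G` and a NORMAL subgroup `H` acting
trivially on `X` (`H ≤ G_{L₀}`, `L₀ ⊇` the field cut out by `X`),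
* `φ|_H` is a homomorphism (`apply_mul_of_fixed`) with `φ(στσ⁻¹) = σ·φ(τ)`
  (`apply_conj_of_fixed`), depending only on the class of `φ` (`apply_eq_of_sub_eq_coboundary`);
* its image `valueSubgroup φ H = φ(H)` is a `G`-stable additive subgroup of `X`
  (`smul_mem_valueSubgroup`) — the input of Lemma 3(i);
* for a pair `(φ, ψ)` of cocycles (of `X`, `Y`): the joint image `jointValueSubgroup φ ψ H =
  {(φ τ, ψ τ)} ⊂ X × Y` is a `G`-stable additive subgroup (`smul_mem_jointValueSubgroup`) whose two
  projections are `φ(H)` and `ψ(H)` (`fst/snd_jointValueSubgroup`) — the module `M = im(h, h^*)`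
  of STEP 1 fed to `Summit.….LevelE.theoremA_contradiction_schema`.
-/

noncomputable section

universe u v

namespace Literature.NumberTheory.GaloisRepresentations.contOneCocycles

variable {R : Type u} [Ring R] [TopologicalSpace R]
variable {G : Type v} [Group G] [TopologicalSpace G]
variable {X Y : TopRep.{v} R G}

/-- On elements acting trivially a crossed homomorphism is additive: `φ(τ g) = φ τ + φ g` when
`τ` acts trivially. [cite: SerreLocalFields1979, VII §5] -/
theorem apply_mul_of_fixed (φ : contOneCocycles X) {τ : G} (hτ : ∀ x : X, X.ρ τ x = x) (g : G) :
    φ.1 (τ * g) = φ.1 τ + φ.1 g := by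
  rw [φ.2 τ g, hτ]

/-- `φ(τ⁻¹) = -φ(τ)` when `τ` acts trivially. [cite: SerreLocalFields1979, VII §5] -/
theorem apply_inv_of_fixed (φ : contOneCocycles X) {τ : G} (hτ : ∀ x : X, X.ρ τ x = x) :
    φ.1 τ⁻¹ = -φ.1 τ := by
  have h := φ.2 τ τ⁻¹
  rw [mul_inv_cancel, contOneCocycles.apply_one, hτ] at h
  rw [eq_neg_iff_add_eq_zero, add_comm, ← h]

/-- **Equivariance of the restriction** (memo (F8): `h := res φ ∈ Hom_G(G_{L₀}, 𝒯)`):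
`φ(σ τ σ⁻¹) = σ·φ(τ)` when `τ` acts trivially. [cite: SerreLocalFields1979, VII §5 Prop. 3] -/
theorem apply_conj_of_fixed (φ : contOneCocycles X) {τ : G} (hτ : ∀ x : X, X.ρ τ x = x) (σ : G) :
    φ.1 (σ * τ * σ⁻¹) = X.ρ σ (φ.1 τ) := by
  have h1 : φ.1 (σ * τ * σ⁻¹) = φ.1 σ + X.ρ σ (φ.1 (τ * σ⁻¹)) := by rw [mul_assoc, φ.2 σ (τ * σ⁻¹)]
  have h3 : φ.1 σ + X.ρ σ (φ.1 σ⁻¹) = 0 := by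
    rw [← φ.2 σ σ⁻¹, mul_inv_cancel, contOneCocycles.apply_one]
  rw [h1, apply_mul_of_fixed φ hτ σ⁻¹, map_add, add_left_comm, h3, add_zero]

/-- **The restriction depends only on the class**: cocycles differing by a coboundary agree on
elements acting trivially. [cite: SerreLocalFields1979, VII §5] -/
theorem apply_eq_of_sub_eq_coboundary (φ ψ : contOneCocycles X) {v : X}
    (h : ∀ g, (φ - ψ).1 g = X.ρ g v - v) {τ : G} (hτ : ∀ x : X, X.ρ τ x = x) : φ.1 τ = ψ.1 τ := by
  have hτ' := h τ
  rw [hτ, sub_self] at hτ'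
  exact sub_eq_zero.mp hτ'

/-- Cocycles with the same class agree on elements acting trivially.
[cite: SerreLocalFields1979, VII §5] -/
theorem apply_eq_of_oneCocycleClass_eq_of_fixed [IsTopologicalGroup G] (φ ψ : contOneCocycles X)
    (h : oneCocycleClass X φ = oneCocycleClass X ψ) {τ : G} (hτ : ∀ x : X, X.ρ τ x = x) :
    φ.1 τ = ψ.1 τ := by
  have h0 : oneCocycleClass X (φ - ψ) = 0 := by rw [oneCocycleClass_sub, h, sub_self]
  obtain ⟨v, hv⟩ := (oneCocycleClass_eq_zero_iff X _).mp h0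
  exact apply_eq_of_sub_eq_coboundary φ ψ hv hτ

/-- **The value group `φ(H)`** of a cocycle on a subgroup `H` acting trivially: an additive subgroup
of `X` (`φ|_H` is a homomorphism). [cite: SerreLocalFields1979, VII §5] -/
def valueSubgroup (φ : contOneCocycles X) (H : Subgroup G) (hH : ∀ τ ∈ H, ∀ x : X, X.ρ τ x = x) :
    AddSubgroup X where
  carrier := {x | ∃ τ ∈ H, φ.1 τ = x}
  zero_mem' := ⟨1, H.one_mem, contOneCocycles.apply_one φ⟩
  add_mem' := by
    rintro a b ⟨τ₁, h₁, rfl⟩ ⟨τ₂, h₂, rfl⟩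
    exact ⟨τ₁ * τ₂, H.mul_mem h₁ h₂, apply_mul_of_fixed φ (hH τ₁ h₁) τ₂⟩
  neg_mem' := by
    rintro a ⟨τ, hτ, rfl⟩
    exact ⟨τ⁻¹, H.inv_mem hτ, apply_inv_of_fixed φ (hH τ hτ)⟩

/-- Membership in the value group. [cite: SerreLocalFields1979, VII §5] -/
theorem mem_valueSubgroup_iff (φ : contOneCocycles X) (H : Subgroup G)
    (hH : ∀ τ ∈ H, ∀ x : X, X.ρ τ x = x) (x : X) :
    x ∈ valueSubgroup φ H hH ↔ ∃ τ ∈ H, φ.1 τ = x := Iff.rfl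

/-- **`φ(H)` is `G`-stable** for `H` normal acting trivially (memo (F8)/STEP 1: "their images are
`G`-submodules"). [cite: SerreLocalFields1979, VII §5 Prop. 3] -/
theorem smul_mem_valueSubgroup (φ : contOneCocycles X) (H : Subgroup G) [H.Normal]
    (hH : ∀ τ ∈ H, ∀ x : X, X.ρ τ x = x) (σ : G) {x : X} (hx : x ∈ valueSubgroup φ H hH) :
    X.ρ σ x ∈ valueSubgroup φ H hH := by
  obtain ⟨τ, hτ, rfl⟩ := hx
  exact ⟨σ * τ * σ⁻¹, Subgroup.Normal.conj_mem inferInstance τ hτ σ,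
    apply_conj_of_fixed φ (hH τ hτ) σ⟩

/-- The value group depends only on the class of the cocycle. [cite: SerreLocalFields1979, VII §5] -/
theorem valueSubgroup_eq_of_oneCocycleClass_eq [IsTopologicalGroup G] (φ ψ : contOneCocycles X)
    (h : oneCocycleClass X φ = oneCocycleClass X ψ) (H : Subgroup G)
    (hH : ∀ τ ∈ H, ∀ x : X, X.ρ τ x = x) : valueSubgroup φ H hH = valueSubgroup ψ H hH := by
  ext x
  simp only [mem_valueSubgroup_iff]
  constructor
  · rintro ⟨τ, hτ, rfl⟩
    exact ⟨τ, hτ, (apply_eq_of_oneCocycleClass_eq_of_fixed φ ψ h (hH τ hτ)).symm⟩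
  · rintro ⟨τ, hτ, rfl⟩
    exact ⟨τ, hτ, apply_eq_of_oneCocycleClass_eq_of_fixed φ ψ h (hH τ hτ)⟩

/-- **The joint value group `(φ, ψ)(H) ⊂ X × Y`** of two cocycles on a subgroup acting trivially
on both modules — the module `M = im(h, h^*)` of STEP 1. [cite: SerreLocalFields1979, VII §5] -/
def jointValueSubgroup (φ : contOneCocycles X) (ψ : contOneCocycles Y) (H : Subgroup G)
    (hX : ∀ τ ∈ H, ∀ x : X, X.ρ τ x = x) (hY : ∀ τ ∈ H, ∀ y : Y, Y.ρ τ y = y) :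
    AddSubgroup (X × Y) where
  carrier := {z | ∃ τ ∈ H, (φ.1 τ, ψ.1 τ) = z}
  zero_mem' := ⟨1, H.one_mem, by rw [contOneCocycles.apply_one, contOneCocycles.apply_one]; rfl⟩
  add_mem' := by
    rintro a b ⟨τ₁, h₁, rfl⟩ ⟨τ₂, h₂, rfl⟩
    exact ⟨τ₁ * τ₂, H.mul_mem h₁ h₂, by
      rw [apply_mul_of_fixed φ (hX τ₁ h₁), apply_mul_of_fixed ψ (hY τ₁ h₁)]; rfl⟩
  neg_mem' := by
    rintro a ⟨τ, hτ, rfl⟩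
    exact ⟨τ⁻¹, H.inv_mem hτ, by
      rw [apply_inv_of_fixed φ (hX τ hτ), apply_inv_of_fixed ψ (hY τ hτ)]; rfl⟩

/-- Membership in the joint value group. [cite: SerreLocalFields1979, VII §5] -/
theorem mem_jointValueSubgroup_iff (φ : contOneCocycles X) (ψ : contOneCocycles Y) (H : Subgroup G)
    (hX : ∀ τ ∈ H, ∀ x : X, X.ρ τ x = x) (hY : ∀ τ ∈ H, ∀ y : Y, Y.ρ τ y = y) (z : X × Y) :
    z ∈ jointValueSubgroup φ ψ H hX hY ↔ ∃ τ ∈ H, (φ.1 τ, ψ.1 τ) = z := Iff.rfl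

/-- **The joint value group is `G`-stable** under the diagonal action (so, in STEP 1, stable under
`(γ₀ − 1) = (T, ι(T))`: the schema's `hM`). [cite: SerreLocalFields1979, VII §5 Prop. 3] -/
theorem smul_mem_jointValueSubgroup (φ : contOneCocycles X) (ψ : contOneCocycles Y) (H : Subgroup G)
    [H.Normal] (hX : ∀ τ ∈ H, ∀ x : X, X.ρ τ x = x) (hY : ∀ τ ∈ H, ∀ y : Y, Y.ρ τ y = y) (σ : G)
    {z : X × Y} (hz : z ∈ jointValueSubgroup φ ψ H hX hY) :
    (X.ρ σ z.1, Y.ρ σ z.2) ∈ jointValueSubgroup φ ψ H hX hY := by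
  obtain ⟨τ, hτ, rfl⟩ := hz
  exact ⟨σ * τ * σ⁻¹, Subgroup.Normal.conj_mem inferInstance τ hτ σ, by
    rw [apply_conj_of_fixed φ (hX τ hτ), apply_conj_of_fixed ψ (hY τ hτ)]⟩

/-- The first projection of the joint value group is `φ(H)` (so "projects onto" ⟺ `φ(H) = ⊤`,
cf. `modPTwist_stable_addSubgroup_eq_top_of_apply_zero_ne_zero`). [cite: SerreLocalFields1979, VII §5] -/
theorem fst_jointValueSubgroup (φ : contOneCocycles X) (ψ : contOneCocycles Y) (H : Subgroup G)
    (hX : ∀ τ ∈ H, ∀ x : X, X.ρ τ x = x) (hY : ∀ τ ∈ H, ∀ y : Y, Y.ρ τ y = y) (x : X) :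
    x ∈ valueSubgroup φ H hX ↔ ∃ z ∈ jointValueSubgroup φ ψ H hX hY, z.1 = x := by
  constructor
  · rintro ⟨τ, hτ, rfl⟩
    exact ⟨(φ.1 τ, ψ.1 τ), ⟨τ, hτ, rfl⟩, rfl⟩
  · rintro ⟨z, ⟨τ, hτ, rfl⟩, rfl⟩
    exact ⟨τ, hτ, rfl⟩

/-- The second projection of the joint value group is `ψ(H)`. [cite: SerreLocalFields1979, VII §5] -/
theorem snd_jointValueSubgroup (φ : contOneCocycles X) (ψ : contOneCocycles Y) (H : Subgroup G)
    (hX : ∀ τ ∈ H, ∀ x : X, X.ρ τ x = x) (hY : ∀ τ ∈ H, ∀ y : Y, Y.ρ τ y = y) (y : Y) :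
    y ∈ valueSubgroup ψ H hY ↔ ∃ z ∈ jointValueSubgroup φ ψ H hX hY, z.2 = y := by
  constructor
  · rintro ⟨τ, hτ, rfl⟩
    exact ⟨(φ.1 τ, ψ.1 τ), ⟨τ, hτ, rfl⟩, rfl⟩
  · rintro ⟨z, ⟨τ, hτ, rfl⟩, rfl⟩
    exact ⟨τ, hτ, rfl⟩

/-- **"`M` projects onto the first factor"** in the form of the kernel schema (`h1` of
`LevelE.theoremA_contradiction_schema`): if `φ(H)` is everything, every `x : X` is the first
component of a joint value. [cite: SerreLocalFields1979, VII §5] -/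
theorem exists_mem_jointValueSubgroup_fst_eq (φ : contOneCocycles X) (ψ : contOneCocycles Y)
    (H : Subgroup G) (hX : ∀ τ ∈ H, ∀ x : X, X.ρ τ x = x) (hY : ∀ τ ∈ H, ∀ y : Y, Y.ρ τ y = y)
    (htop : valueSubgroup φ H hX = ⊤) (x : X) :
    ∃ z ∈ jointValueSubgroup φ ψ H hX hY, z.1 = x :=
  (fst_jointValueSubgroup φ ψ H hX hY x).mp (htop ▸ AddSubgroup.mem_top x)

/-- **"`M` projects onto the second factor"** (`h2'` of the kernel schema): if `ψ(H)` is
everything, every `y : Y` is the second component of a joint value. [cite: SerreLocalFields1979, VII §5] -/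
theorem exists_mem_jointValueSubgroup_snd_eq (φ : contOneCocycles X) (ψ : contOneCocycles Y)
    (H : Subgroup G) (hX : ∀ τ ∈ H, ∀ x : X, X.ρ τ x = x) (hY : ∀ τ ∈ H, ∀ y : Y, Y.ρ τ y = y)
    (htop : valueSubgroup ψ H hY = ⊤) (y : Y) :
    ∃ z ∈ jointValueSubgroup φ ψ H hX hY, z.2 = y :=
  (snd_jointValueSubgroup φ ψ H hX hY y).mp (htop ▸ AddSubgroup.mem_top y)

end Literature.NumberTheory.GaloisRepresentations.contOneCocycles

end
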